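import Summits.QuantumFields.YangMills.Theorems.GronwallGapAnalyticDetourStrongCouplingWindow

/-!
# Crux `AnalyticDetour` (stmt-QuantumFields-8801), line `registered`:
# stub B (`stub_localBypass`) holds INSIDE the strong-coupling window, and at every coupling
# with a Gateaux-regular Wilson neighbourhood

Route `GronwallGap`, sub-problem `YangMills`.  Stub B of the cycle-3 reshape
(`analyticDetour_iff_bypass : AnalyticDetour ↔ (A ∧ B)`) asks: for every compact simple `G`,
lattice representation `r` and coupling `βc > 0` there is `δ > 0` such that any two Wilson points
`βm ∈ (βc - δ, βc)`, `βp ∈ (βc, βc + δ)`, `βm > 0`, whose weights `exp(β Re tr r.ρ)` have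
Gateaux-analytic torus pressure (`AnP`), are joined by an ADMISSIBLE single-plaquette weight path
(`Adm`: continuous, positive, class function, inversion-symmetric, positive type, log-Lipschitz in
the parameter) that is Gateaux-regular (`AnP`) at every parameter.

This file records the part of B that is a THEOREM now, and isolates where its content lies:

* `localBypass_of_regularNhds` — if the Wilson axis of `r` is Gateaux-regular on a whole
  neighbourhood `(βc - ε, βc + ε) ∩ (0, ∞)` of `βc`, the body of B holds at `βc` with `δ := ε`:
  the straight Wilson segment `s ↦ exp(((1-s)βm + sβp) Re tr r.ρ)` is admissible
  (`stub_wilsonSegmentAdm`, `stub_expPosSemidef`) and its running coupling stays in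
  `[βm, βp] ⊂ (βc - ε, βc + ε)`.  So B is automatic at every coupling off the CLOSURE of the
  Gateaux-singular set; under stub A (that set is locally finite) the whole content of B sits at
  the isolated singular couplings themselves (first-order bulk points, e.g. the van
  Enter–Shlosman coupling of `(ℂ² ⊕ ℂ ⊕ ℂ)^⊗(p+1)` on `SU(2)`,
  `GronwallGapAnalyticDetourExceptionalSetNecessary`), where a genuine off-axis detour inside the
  positive-type cone is needed — open.
* `wilsonAxisRegular_of_window` — the Wilson axis is Gateaux-regular on the strong-coupling
  window `(0, β₁(r))` of `stub_strongCouplingWindow` (endpoint `s = 0` of the window's own path).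
* `localBypass_of_window` — B for every `βc` inside the window, `δ := β₁ - βc`, with NO regularity
  hypotheses on the endpoints: both endpoints then lie in `(0, β₁)` and the window theorem joins
  them.

All three are unconditional consequences of landed theorems (`stub_strongCouplingWindow`,
`stub_wilsonSegmentAdm`, `stub_expPosSemidef`); they do not close stub B (the case `βc ≥ β₁(r)`
at a singular coupling is open mathematics).  No named facts; no definitions.
-/

noncomputable section

namespace Summit.QuantumFields.YangMills.Theorems

open scoped BigOperators

/-- **B at a coupling with a Gateaux-regular Wilson neighbourhood.**  If every Wilson weight
`exp(β Re tr r.ρ)` with `β ∈ (βc - ε, βc + ε)`, `β > 0`, has Gateaux-analytic torus pressure, then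
the body of stub B holds at `βc` with `δ := ε`: the Wilson segment from `βm` to `βp` is admissible
(`stub_wilsonSegmentAdm`) and its running coupling `(1-s)βm + sβp ∈ [βm, βp]` stays in the regular
neighbourhood.  (The two endpoint-regularity hypotheses of B are not even used.) -/
theorem localBypass_of_regularNhds :
    ∀ (G : Type) [Group G] [TopologicalSpace G] [IsTopologicalGroup G] [CompactSpace G], Literature.MathematicalPhysics.QuantumFieldTheory.IsCompactSimpleLieGroup G → letI : MeasurableSpace G := borel G; haveI : BorelSpace G := ⟨rfl⟩; let Pseq : (G → ℝ) → ℕ → ℝ := fun v L => (((L + 1 : ℕ) : ℝ) ^ 4)⁻¹ * Real.log (((MeasureTheory.Measure.pi fun _ : Literature.MathematicalPhysics.QuantumFieldTheory.Edge 4 (L + 1) => Literature.MathematicalPhysics.QuantumFieldTheory.haarProbability G).withDensity (fun U : Literature.MathematicalPhysics.QuantumFieldTheory.GaugeConfig 4 (L + 1) G => ENNReal.ofReal (Literature.MathematicalPhysics.QuantumLattice.groupHeatKernelWeight (fun _ : ℝ => v) 0 U))) Set.univ).toReal; let AnP : (G → ℝ) → Prop := fun v => ∀ φ : G → ℝ,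 Continuous φ → (∀ g h : G, φ (h * g * h⁻¹) = φ g) → ∃ p : ℝ → ℝ, (∀ t : ℝ, Filter.Tendsto (fun L : ℕ => Pseq (fun g => v g * Real.exp (t * φ g)) L) Filter.atTop (nhds (p t))) ∧ AnalyticAt ℝ p 0; let Adm : (ℝ → G → ℝ) → Prop := fun w => (∀ s ∈ Set.Icc (0 : ℝ) 1, Continuous (w s) ∧ (∀ g : G, 0 < w s g) ∧ (∀ g h : G, w s (h * g * h⁻¹) = w s g) ∧ (∀ g : G, w s g⁻¹ = w s g) ∧ (∀ (n : ℕ) (x : Fin n → G) (c : Fin n → ℂ), 0 ≤ (∑ i, ∑ j, (starRingEnd ℂ) (c i) * c j * ((w s ((x i)⁻¹ * x j) : ℝ) : ℂ)).re)) ∧ ∃ Λ : ℝ, ∀ s ∈ Set.Icc (0 : ℝ) 1, ∀ s' ∈ Set.Icc (0 : ℝ) 1, ∀ g : G, |Real.log (w s g) - Real.log (w s' g)| ≤ Λ * |s - s'|; ∀ r : Literature.MathematicalPhysics.QuantumFieldTheory.LatticeRep G, ∀ βc : ℝ, 0 < βc → ∀ ε : ℝ, 0 < ε → (∀ β ∈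 Set.Ioo (βc - ε) (βc + ε), 0 < β → AnP (fun g => Real.exp (β * (r.ρ g).trace.re))) → ∃ δ : ℝ, 0 < δ ∧ ∀ βm ∈ Set.Ioo (βc - δ) βc, ∀ βp ∈ Set.Ioo βc (βc + δ), 0 < βm → AnP (fun g => Real.exp (βm * (r.ρ g).trace.re)) → AnP (fun g => Real.exp (βp * (r.ρ g).trace.re)) → ∃ w : ℝ → G → ℝ, Adm w ∧ (∀ s ∈ Set.Icc (0 : ℝ) 1, AnP (w s)) ∧ w 0 = (fun g => Real.exp (βm * (r.ρ g).trace.re)) ∧ w 1 = (fun g => Real.exp (βp * (r.ρ g).trace.re)) := by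
  intro G i1 i2 i3 i4 hG Pseq AnP Adm r βc hβc ε hε hreg
  refine ⟨ε, hε, fun βm hm βp hp hm0 _ _ => ?_⟩
  obtain ⟨hm1, hm2⟩ := hm
  obtain ⟨hp1, hp2⟩ := hp
  have hp0 : 0 < βp := hβc.trans hp1
  refine ⟨fun s g => Real.exp (((1 - s) * βm + s * βp) * (r.ρ g).trace.re),
    stub_wilsonSegmentAdm stub_expPosSemidef G hG r βm βp hm0.le hp0.le, ?_, ?_, ?_⟩
  · intro s hs
    obtain ⟨hs0, hs1⟩ := hs
    have hlo : βm ≤ (1 - s) * βm + s * βp := by nlinarith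
    have hhi : (1 - s) * βm + s * βp ≤ βp := by nlinarith
    exact hreg _ ⟨by linarith, by linarith⟩ (lt_of_lt_of_le hm0 hlo)
  · funext g
    norm_num
  · funext g
    norm_num

/-- **The strong-coupling window is Gateaux-regular on the Wilson axis.**  With `β₁ = β₁(r) > 0`
from `stub_strongCouplingWindow`, every Wilson weight `exp(β Re tr r.ρ)`, `β ∈ (0, β₁)`, has
Gateaux-analytic torus pressure in every continuous class direction: it is the `s = 0` end of the
window's admissible regular path from `β` to `β`. -/
theorem wilsonAxisRegular_of_window :
    ∀ (G : Type) [Group G] [TopologicalSpace G] [IsTopologicalGroup G] [CompactSpace G], Literature.MathematicalPhysics.QuantumFieldTheory.IsCompactSimpleLieGroup G → letI : MeasurableSpace G := borel G; haveI : BorelSpace G := ⟨rfl⟩; let Pseq : (G → ℝ) → ℕ → ℝ := fun v L => (((L + 1 : ℕ) : ℝ) ^ 4)⁻¹ * Real.log (((MeasureTheory.Measure.pi fun _ : Literature.MathematicalPhysics.QuantumFieldTheory.Edge 4 (L + 1) => Literature.MathematicalPhysics.QuantumFieldTheory.haarProbability G).withDensity (fun U : Literature.MathematicalPhysics.QuantumFieldTheory.GaugeConfig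 4 (L + 1) G => ENNReal.ofReal (Literature.MathematicalPhysics.QuantumLattice.groupHeatKernelWeight (fun _ : ℝ => v) 0 U))) Set.univ).toReal; let AnP : (G → ℝ) → Prop := fun v => ∀ φ : G → ℝ, Continuous φ → (∀ g h : G, φ (h * g * h⁻¹) = φ g) → ∃ p : ℝ → ℝ, (∀ t : ℝ, Filter.Tendsto (fun L : ℕ => Pseq (fun g => v g * Real.exp (t * φ g)) L) Filter.atTop (nhds (p t))) ∧ AnalyticAt ℝ p 0; ∀ r : Literature.MathematicalPhysics.QuantumFieldTheory.LatticeRep G, ∃ β₁ : ℝ, 0 < β₁ ∧ ∀ β ∈ Set.Ioo (0 : ℝ) β₁, AnP (fun g => Real.exp (β * (r.ρ g).trace.re)) := by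
  intro G i1 i2 i3 i4 hG Pseq AnP r
  obtain ⟨β₁, hβ₁, hW⟩ := stub_strongCouplingWindow G hG r
  refine ⟨β₁, hβ₁, fun β hβ => ?_⟩
  obtain ⟨w, _hAdm, hAn, h0, _h1⟩ := hW β hβ β hβ
  have h := hAn 0 ⟨le_rfl, zero_le_one⟩
  rw [h0] at h
  exact h

/-- **B inside the strong-coupling window.**  For every compact simple `G` and lattice
representation `r` there is `β₁ > 0` (that of `stub_strongCouplingWindow`) such that stub B holds at
every `βc ∈ (0, β₁)` with `δ := β₁ - βc` and without any regularity hypothesis on the endpoints: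
`βm ∈ (βc - δ, βc)`, `βm > 0` and `βp ∈ (βc, βc + δ)` both lie in `(0, β₁)`, and the window theorem
joins them by an admissible path with Gateaux-analytic pressure at every parameter. -/
theorem localBypass_of_window :
    ∀ (G : Type) [Group G] [TopologicalSpace G] [IsTopologicalGroup G] [CompactSpace G], Literature.MathematicalPhysics.QuantumFieldTheory.IsCompactSimpleLieGroup G → letI : MeasurableSpace G := borel G; haveI : BorelSpace G := ⟨rfl⟩; let Pseq : (G → ℝ) → ℕ → ℝ := fun v L => (((L + 1 : ℕ) : ℝ) ^ 4)⁻¹ * Real.log (((MeasureTheory.Measure.pi fun _ : Literature.MathematicalPhysics.QuantumFieldTheory.Edge 4 (L + 1) => Literature.MathematicalPhysics.QuantumFieldTheory.haarProbability G).withDensity (fun U : Literature.MathematicalPhysics.QuantumFieldTheory.GaugeConfig 4 (L + 1) G => ENNReal.ofReal (Literature.MathematicalPhysics.QuantumLattice.groupHeatKernelWeight (fun _ : ℝ => v) 0 U))) Set.univ).toReal; let AnP : (G → ℝ) → Prop := fun v => ∀ φ : G → ℝ, Continuous φ → (∀ g h : G, φ (h * g * h⁻¹) = φ g) → ∃ p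 : ℝ → ℝ, (∀ t : ℝ, Filter.Tendsto (fun L : ℕ => Pseq (fun g => v g * Real.exp (t * φ g)) L) Filter.atTop (nhds (p t))) ∧ AnalyticAt ℝ p 0; let Adm : (ℝ → G → ℝ) → Prop := fun w => (∀ s ∈ Set.Icc (0 : ℝ) 1, Continuous (w s) ∧ (∀ g : G, 0 < w s g) ∧ (∀ g h : G, w s (h * g * h⁻¹) = w s g) ∧ (∀ g : G, w s g⁻¹ = w s g) ∧ (∀ (n : ℕ) (x : Fin n → G) (c : Fin n → ℂ), 0 ≤ (∑ i, ∑ j, (starRingEnd ℂ) (c i) * c j * ((w s ((x i)⁻¹ * x j) : ℝ) : ℂ)).re)) ∧ ∃ Λ : ℝ, ∀ s ∈ Set.Icc (0 : ℝ) 1, ∀ s' ∈ Set.Icc (0 : ℝ) 1, ∀ g : G, |Real.log (w s g) - Real.log (w s' g)| ≤ Λ * |s - s'|; ∀ r : Literature.MathematicalPhysics.QuantumFieldTheory.LatticeRep G, ∃ β₁ : ℝ, 0 < β₁ ∧ ∀ βc ∈ Set.Ioo (0 : ℝ) β₁, ∃ δ : ℝ, 0 < δ ∧ ∀ βm ∈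 Set.Ioo (βc - δ) βc, ∀ βp ∈ Set.Ioo βc (βc + δ), 0 < βm → ∃ w : ℝ → G → ℝ, Adm w ∧ (∀ s ∈ Set.Icc (0 : ℝ) 1, AnP (w s)) ∧ w 0 = (fun g => Real.exp (βm * (r.ρ g).trace.re)) ∧ w 1 = (fun g => Real.exp (βp * (r.ρ g).trace.re)) := by
  intro G i1 i2 i3 i4 hG Pseq AnP Adm r
  obtain ⟨β₁, hβ₁, hW⟩ := stub_strongCouplingWindow G hG r
  refine ⟨β₁, hβ₁, fun βc hβc => ⟨β₁ - βc, sub_pos.mpr hβc.2, fun βm hm βp hp hm0 => ?_⟩⟩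
  obtain ⟨hc1, hc2⟩ := hβc
  obtain ⟨hm1, hm2⟩ := hm
  obtain ⟨hp1, hp2⟩ := hp
  exact hW βm ⟨hm0, by linarith⟩ βp ⟨by linarith, by linarith⟩

end Summit.QuantumFields.YangMills.Theorems

end
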